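import Summits.BirchSwinnertonDyer.BirchSwinnertonDyer.Theorems.GenusKolyvaginAtTwoCasselsTateTotallyComplex
import Summits.BirchSwinnertonDyer.BirchSwinnertonDyer.Theorems.GenusKolyvaginAtTwoShaCardDvdPowAtTwoRSquareAllowance
import Literature.NumberTheory.EllipticCurves.HeegnerPointsImaginaryQuadraticProofs
import HarnessLib

/-!
# `#Ш(E/K)[p^∞]` is a square (when finite) for every elliptic curve over a TOTALLY COMPLEX number field, unconditionally;
# and "U with one free bit ⟹ U" (`ShaCardDvdPowAtTwoR`) with NO named fact

Route `GenusKolyvaginAtTwo`, cruxes `GenusPrimitiveSupplyAtTwo` (stmt-BirchSwinnertonDyer-22136) / U `ShaCardDvdPowAtTwoR`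
(stmt-BirchSwinnertonDyer-28029); seat `bsd-line-gk2-p1` g12 (LEAD, cell `bsd-f1-sign2`),
`--supports 22136`, helper. THEOREMS ONLY (no definition, no named fact, no `sorry`, no instance).

With the Cassels–Tate theorem over a totally complex field now in the tree UNCONDITIONALLY
(`CasselsTateTotallyComplex.exists_casselsTate_pairing_of_isTotallyComplex`: gk2-p2's totally complex assembly p670316 + this
seat's alternation theorem `ctGeneralFun_self_eq_zero`), the hypothesis `hCT : exists_casselsTate_pairing (K := K)` of the
K-frame theorems of seats gk2-p3 / gk2-p2 is DISCHARGED whenever `K` is totally complex — in particular for the imaginary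
quadratic Heegner fields of the route (`IsImaginaryQuadratic.isTotallyComplex`):

* `isSquare_natCard_primaryComponent_sha` — `#Ш(E/K)[p^∞]` is a square when finite, every prime `p`, every `E/K`, `K` totally
  complex (`VisiblePairAtTwo.isSquare_natCard_primaryComponent_sha_of_casselsTate` made unconditional);
* `natCard_sha_dvd_pow_of_dvd_pow_succ` — `#Ш(E/K)[2^∞] ∣ 2^{2M₀+1} ⟹ ∣ 2^{2M₀}` over a totally complex `K`, unconditionally;
* **`shaCardDvdPowAtTwoR_of_allowance_one`** — "U with ONE FREE BIT implies U": the route statement `ShaCardDvdPowAtTwoR` from its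
  one-bit-weaker form `h₁` ALONE (gk2-p3's `VisiblePairAtTwo.shaCardDvdPowAtTwoR_of_allowance_one` without its hypothesis
  `hCT : ∀ K, exists_casselsTate_pairing (K := K)` — the item's `K` is imaginary quadratic);
(The genus-restriction divisibility `#Ш(E/ℚ)[2^∞] ∣ #Ш(E_K)[2^∞]` with the `K`-side fact discharged is gk2-p3 g16's
`GenusKolyvaginAtTwoPowDvdShaCardAtTwoRTGenusRestrictionDvdCT`, not repeated here.)

BSD is not proved by any of this.

References: [Cassels1962ArithmeticIV]; [MilneADT2006] I §6 Thm. 6.13; [SilvermanAEC2009] Thm. X.4.14; [McCallumLMS1991] Thm. 5.4.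
-/

noncomputable section

open scoped Classical

-- the Theorems namespace of this sub repeats the summit name by design (D-0017 nested layout)
set_option linter.dupNamespace false
set_option autoImplicit false

namespace Summit.BirchSwinnertonDyer.BirchSwinnertonDyer.Theorems.GenusExact.CasselsTateTotallyComplex

open _root_.WeierstrassCurve NumberField
open Literature.NumberTheory.EllipticCurves Literature.GroupTheory.FiniteAbelian
open Summit.BirchSwinnertonDyer.BirchSwinnertonDyer.Theorems.GenusExact

universe u

/-! ## §1 Square order and the one-bit reduction over a totally complex field -/

section Sha

variable {K : Type} [Field K] [NumberField K] (V : WeierstrassCurve K) [V.IsElliptic] (p : ℕ) [hp : Fact p.Prime]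

/-- **`#Ш(E/K)[p^∞]` is a square when finite, for every elliptic curve over a totally complex number field and every prime `p`,
UNCONDITIONALLY** (Cassels–Tate over `K` is the tree's theorem `exists_casselsTate_pairing_of_isTotallyComplex`).
[cite: SilvermanAEC2009, Thm. X.4.14] [cite: Cassels1962ArithmeticIV] -/
theorem isSquare_natCard_primaryComponent_sha [IsTotallyComplex K] [Finite (AddCommGroup.primaryComponent V.sha p)] :
    IsSquare (Nat.card (AddCommGroup.primaryComponent V.sha p)) :=
  VisiblePairAtTwo.isSquare_natCard_primaryComponent_sha_of_casselsTate V p exists_casselsTate_pairing_of_isTotallyComplex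

/-- The same for an imaginary quadratic field (the Heegner fields of the route). [cite: SilvermanAEC2009, Thm. X.4.14]
[cite: Cassels1962ArithmeticIV] -/
theorem isSquare_natCard_primaryComponent_sha_of_isImaginaryQuadratic (hK : IsImaginaryQuadratic K)
    [Finite (AddCommGroup.primaryComponent V.sha p)] : IsSquare (Nat.card (AddCommGroup.primaryComponent V.sha p)) := by
  haveI : IsTotallyComplex K := hK.isTotallyComplex
  exact isSquare_natCard_primaryComponent_sha V p

omit [V.IsElliptic] hp in
/-- **Pointwise one-bit reduction at `p = 2` over a totally complex field, unconditionally**: if `#Ш(E/K)[2^∞] ∣ 2^{2M₀+1}` then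
`#Ш(E/K)[2^∞] ∣ 2^{2M₀}`. [cite: SilvermanAEC2009, Thm. X.4.14] [cite: McCallumLMS1991, Thm. 5.4] -/
theorem natCard_sha_dvd_pow_of_dvd_pow_succ [IsTotallyComplex K] [V.IsElliptic] {M₀ : ℕ}
    (h : Nat.card (AddCommGroup.primaryComponent V.sha 2) ∣ 2 ^ (2 * M₀ + 1)) :
    Nat.card (AddCommGroup.primaryComponent V.sha 2) ∣ 2 ^ (2 * M₀) :=
  VisiblePairAtTwo.natCard_sha_dvd_pow_of_dvd_pow_succ exists_casselsTate_pairing_of_isTotallyComplex V h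

end Sha

/-! ## §2 U with one free bit implies U — no named fact -/

open Literature.NumberTheory.GaloisRepresentations in
/-- **U with ONE FREE BIT implies U** (`ShaCardDvdPowAtTwoR`, stmt-BirchSwinnertonDyer-28029), UNCONDITIONALLY: the hypothesis
`h₁` is the statement of `ShaCardDvdPowAtTwoR` VERBATIM except that its conclusion reads `∣ 2 ^ (2 * M₀ + 1)`; the item's field
`K` is imaginary quadratic, hence totally complex, so the Cassels–Tate fact over `K` used by gk2-p3's
`VisiblePairAtTwo.shaCardDvdPowAtTwoR_of_allowance_one` is the tree's theorem. [cite: SilvermanAEC2009, Thm. X.4.14]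
[cite: McCallumLMS1991, Thm. 5.4] [cite: Cassels1962ArithmeticIV] -/
theorem shaCardDvdPowAtTwoR_of_allowance_one
    (h₁ : Theses.GenusKolyvaginAtTwo.KolyvaginRelationAtTwo → Theses.GenusKolyvaginAtTwo.EquivariantChebotarevAtTwoR →
      (∀ (W : WeierstrassCurve ℚ) [W.IsElliptic], W.Δ < 0 → ∀ (c₀ : Field.absoluteGaloisGroup ℚ),
        IsComplexConjugation (Rat.castHom ℝ) c₀ → ∀ (M : ℕ), ∃ P : W.geomTorsion ((2 ^ M : ℕ) : ℤ),
          ∀ Q : W.geomTorsion ((2 ^ M : ℕ) : ℤ), ∃ a b : ℤ, Q = a • P + b • (c₀ • P)) →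
      ∀ (W : WeierstrassCurve ℚ) [W.IsElliptic] [W.IsGloballyMinimal] [NeZero (W.conductorNorm ℤ)], ¬ W.HasCM →
        W.Δ < 0 → ∀ (K : Type) [Field K] [NumberField K], IsImaginaryQuadratic K → Odd (NumberField.discr K) →
        NumberField.discr K ≠ -3 → SatisfiesHeegnerHypothesis (W.conductorNorm ℤ) K →
        ¬ IsSquare ((NumberField.discr K : ℚ) * -|W.Δ|) → ¬ IsSquare ((NumberField.discr K : ℚ) * (-(2 * |W.Δ|))) →
        (∀ n : ℕ, 0 < n → W.HasSurjectiveModNGaloisRep ((2 : ℤ) ^ n)) →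
        ∀ (Dt : ModularForms.ModularParametrizationData W (W.conductorNorm ℤ)) (β : ℤ) (ι : K →+* ℂ)
          (d₁ : KolyvaginHeegnerData Dt β ι 1), ¬ IsOfFinAddOrder d₁.derivedPoint → ∀ (M₀ : ℕ),
          (∃ Q : (W.baseChange (ringClassField K ι 1)).toAffine.Point, ((2 ^ M₀ : ℕ) : ℤ) • Q = d₁.derivedPoint) →
          (¬ ∃ Q : (W.baseChange (ringClassField K ι 1)).toAffine.Point,
            ((2 ^ (M₀ + 1) : ℕ) : ℤ) • Q = d₁.derivedPoint) →
          ∀ (n : ℕ) (d : KolyvaginHeegnerData Dt β ι n), Squarefree n →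
            (∀ ℓ ∈ n.primeFactors, Zhang2014.IsKolyvaginPrime (W.conductorNorm ℤ) W K 2 ℓ) →
            (¬ ∃ Q : (W.baseChange (ringClassField K ι n)).toAffine.Point, (2 : ℤ) • Q = d.derivedPoint) →
            Nat.card (AddCommGroup.primaryComponent (W.baseChange K).sha 2) ∣ 2 ^ (2 * M₀ + 1)) :
    Theses.GenusKolyvaginAtTwo.ShaCardDvdPowAtTwoR := by
  intro hQ2 hQ5 hQ1 W _ _ _ hcm hΔ K _ _ hK hodd h3 hH hsq hsq2 hsurj Dt β ι d₁ hy M₀ hdiv hndiv n d hn hKol hprim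
  haveI : IsTotallyComplex K := hK.isTotallyComplex
  haveI : (W.baseChange K).IsElliptic := by rw [WeierstrassCurve.baseChange]; infer_instance
  exact natCard_sha_dvd_pow_of_dvd_pow_succ (W.baseChange K)
    (h₁ hQ2 hQ5 hQ1 W hcm hΔ K hK hodd h3 hH hsq hsq2 hsurj Dt β ι d₁ hy M₀ hdiv hndiv n d hn hKol hprim)

end Summit.BirchSwinnertonDyer.BirchSwinnertonDyer.Theorems.GenusExact.CasselsTateTotallyComplex

end
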